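import Summits.AtomisticToContinuum.HydrodynamicLimit.Theorems.KineticFluxLdDecay.Negative.TiltBasics
import Literature.Analysis.FluidPDE.HardSphereFlowRegular

/-!
# Gibbs tilts for `KineticFluxLdDecay` (2/5): velocity marginal, window average, and the tilt lower bound

(E) the velocity marginal of the homogeneous Gibbs measure is `N(u, θ)^{⊗(N+1)}`
(`map_vel_localGibbsMeasure_const`); (F) the regular (jointly measurable) Alexander flow of the crux
`regFlowCrux`, the identity "expectation of a kinetic-window time average under an invariant Gibbs law = static
expectation" (`integral_windowAvg_regFlowCrux`, Fubini + `(Φ_s)_# G = G`), the MAIN LEMMA `tilt_lower_bound`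
`exp((N+1) ∫ [g(u₁ + √θ₁ w) + llr1(u₁ + √θ₁ w)] dγ) ≤ ∫⁻ exp(h⁻¹ ∫₀ʰ ∑ᵢ g(vᵢ(s)) ds) dG_N` for EVERY window
`h` and EVERY `N`, and tightness from below `one_le_lintegral_exp_window` (`Λ ≥ 0` for centred `g`).
refuter-cdisprove-stmt-AtomisticToContinuum-10967-0.
-/

noncomputable section

open MeasureTheory ProbabilityTheory Real
open scoped ENNReal InnerProductSpace

namespace Summit.AtomisticToContinuum.HydrodynamicLimit.Theorems
namespace KineticFluxLdDecayTilt

section VelMarginal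

open Literature.Analysis.FluidPDE Literature.MathematicalPhysics.KineticTheory

/-! ### E. The velocity marginal of the homogeneous Gibbs measure -/

/-- **Velocities are i.i.d. Gaussians under the homogeneous Gibbs measure**: the velocity marginal of
`localGibbsMeasure σ a u θ N` (constant profiles, `σ ≤ 1/2`) is `N(u, θ)^{⊗(N+1)}`. [folklore] -/
theorem map_vel_localGibbsMeasure_const (σ a θ : ℝ) (u : V3) (ha : 0 < a) (hθ : 0 < θ)
    (hσ2 : σ ≤ 1 / 2) (N : ℕ) :
    (localGibbsMeasure σ (fun _ => a) (fun _ => u) (fun _ => θ) N).map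
        (fun z : Config (N + 1) (Fin 3) T3 => fun i => (z i).2) =
      Measure.pi (fun _ : Fin (N + 1) => gaussMeasure u θ) := by
  haveI := isProbabilityMeasure_localGibbsMeasure (a₀ := fun _ => a) (θ₀ := fun _ => θ)
    (u₀ := fun _ => u) continuous_const continuous_const continuous_const (fun _ => ha)
    (fun _ => hθ) hσ2 N
  have hvelm : Measurable fun z : Config (N + 1) (Fin 3) T3 => fun i => (z i).2 :=
    measurable_pi_lambda _ fun i => (measurable_pi_apply i).snd
  ext A hA
  rw [Measure.map_apply hvelm hA, ← lintegral_indicator_one (hvelm hA),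
    lintegral_localGibbsMeasure continuous_const continuous_const continuous_const
      (fun _ => ha.le) (fun _ => hθ) σ N (measurable_one.indicator (hvelm hA))]
  have hind : ∀ (x : Fin (N + 1) → T3) (v : Fin (N + 1) → V3),
      ((fun z : Config (N + 1) (Fin 3) T3 => fun i => (z i).2) ⁻¹' A).indicator
        (1 : Config (N + 1) (Fin 3) T3 → ℝ≥0∞) (zipConfig (x, v)) = A.indicator 1 v := by
    intro x v
    have hv : (fun i => (zipConfig (x, v) i).2) = v := funext fun i => by simp
    by_cases hvA : v ∈ A
    · rw [Set.indicator_of_mem hvA, Set.indicator_of_mem (show zipConfig (x, v) ∈ _ by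
        simpa [Set.mem_preimage, hv] using hvA)]
      rfl
    · rw [Set.indicator_of_notMem hvA, Set.indicator_of_notMem (show zipConfig (x, v) ∉ _ by
        simpa [Set.mem_preimage, hv] using hvA)]
  have hvel : ∀ x : Fin (N + 1) → T3, velMeasure (fun _ => u) (fun _ => θ) x =
      Measure.pi (fun _ : Fin (N + 1) => gaussMeasure u θ) := fun x => rfl
  simp_rw [hind, lintegral_indicator_one hA, hvel]
  rw [lintegral_mul_const _ ?_, lintegral_posWeight_eq_one continuous_const continuous_const
      continuous_const (fun _ => ha.le) (fun _ => hθ) σ N, one_mul]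
  exact (measurable_const.mul (measurable_posWeight continuous_const _ _)).ennreal_ofReal

/-- Integrability of a sum of one-body velocity functions under the homogeneous Gibbs measure.
[folklore] -/
theorem integrable_sum_vel_localGibbsMeasure_const (σ a θ : ℝ) (u : V3) (ha : 0 < a) (hθ : 0 < θ)
    (hσ2 : σ ≤ 1 / 2) (N : ℕ) {f : V3 → ℝ} (hf : Integrable f (gaussMeasure u θ)) :
    Integrable (fun z : Config (N + 1) (Fin 3) T3 => ∑ i, f ((z i).2))
      (localGibbsMeasure σ (fun _ => a) (fun _ => u) (fun _ => θ) N) := by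
  have hvelm : Measurable fun z : Config (N + 1) (Fin 3) T3 => fun i => (z i).2 :=
    measurable_pi_lambda _ fun i => (measurable_pi_apply i).snd
  have hmap := map_vel_localGibbsMeasure_const σ a θ u ha hθ hσ2 N
  have hmp : MeasurePreserving (fun z : Config (N + 1) (Fin 3) T3 => fun i => (z i).2)
      (localGibbsMeasure σ (fun _ => a) (fun _ => u) (fun _ => θ) N)
      (Measure.pi (fun _ : Fin (N + 1) => gaussMeasure u θ)) := ⟨hvelm, hmap⟩
  have hint : Integrable (fun v : Fin (N + 1) → V3 => ∑ i, f (v i))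
      (Measure.pi (fun _ : Fin (N + 1) => gaussMeasure u θ)) :=
    integrable_finsetSum _ fun i _ =>
      ((measurePreserving_eval (fun _ : Fin (N + 1) => gaussMeasure u θ) i).integrable_comp
        hf.aestronglyMeasurable).2 hf
  exact (hmp.integrable_comp hint.aestronglyMeasurable).2 hint

/-- Expectation of a sum of one-body velocity functions under the homogeneous Gibbs measure:
`∫ ∑ᵢ f(vᵢ) dG = (N+1) ∫ f dN(u, θ)`. [folklore] -/
theorem integral_sum_vel_localGibbsMeasure_const (σ a θ : ℝ) (u : V3) (ha : 0 < a) (hθ : 0 < θ)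
    (hσ2 : σ ≤ 1 / 2) (N : ℕ) {f : V3 → ℝ} (hf : Integrable f (gaussMeasure u θ)) :
    ∫ z, ∑ i, f ((z i).2) ∂localGibbsMeasure σ (fun _ => a) (fun _ => u) (fun _ => θ) N =
      ((N + 1 : ℕ) : ℝ) * ∫ v, f v ∂gaussMeasure u θ := by
  have hvelm : Measurable fun z : Config (N + 1) (Fin 3) T3 => fun i => (z i).2 :=
    measurable_pi_lambda _ fun i => (measurable_pi_apply i).snd
  have hmap := map_vel_localGibbsMeasure_const σ a θ u ha hθ hσ2 N
  have hint : Integrable (fun v : Fin (N + 1) → V3 => ∑ i, f (v i))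
      (Measure.pi (fun _ : Fin (N + 1) => gaussMeasure u θ)) :=
    integrable_finsetSum _ fun i _ =>
      ((measurePreserving_eval (fun _ : Fin (N + 1) => gaussMeasure u θ) i).integrable_comp
        hf.aestronglyMeasurable).2 hf
  have h1 : AEStronglyMeasurable (fun v : Fin (N + 1) → V3 => ∑ i, f (v i))
      ((localGibbsMeasure σ (fun _ => a) (fun _ => u) (fun _ => θ) N).map
        (fun z : Config (N + 1) (Fin 3) T3 => fun i => (z i).2)) := by
    rw [hmap]
    exact hint.aestronglyMeasurable
  calc ∫ z, ∑ i, f ((z i).2) ∂localGibbsMeasure σ (fun _ => a) (fun _ => u) (fun _ => θ) N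
      = ∫ v, ∑ i, f (v i) ∂((localGibbsMeasure σ (fun _ => a) (fun _ => u) (fun _ => θ) N).map
          (fun z : Config (N + 1) (Fin 3) T3 => fun i => (z i).2)) :=
        (integral_map hvelm.aemeasurable h1).symm
    _ = _ := by rw [hmap, integral_sum_eval_pi _ hf]

end VelMarginal

/-! ### F. The regular flow, the window average, and the tilt lower bound -/

section Assembly

open Literature.Analysis.FluidPDE Literature.MathematicalPhysics.KineticTheory

/-- The regularised (jointly measurable) Alexander flow of the crux at reduced density `σ` and
particle number `N + 1` (`HardSphereFlowRegular`). [folklore] -/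
def regFlowCrux {σ : ℝ} (hσ : 0 < σ) (hσ' : σ < 2⁻¹) (N : ℕ) :
    HardSphereFlow (Torus.geometry (Fin 3)) (hsDiameter σ N) (N + 1) :=
  Alexander.regHardSphereFlow (d := Fin 3) (hsDiameter_pos hσ N)
    ((hsDiameter_le hσ.le N).trans_lt hσ') (N + 1)

/-- Joint measurability of the regular flow in `(t, z)`. [folklore] -/
theorem measurable_regFlowCrux_uncurry {σ : ℝ} (hσ : 0 < σ) (hσ' : σ < 2⁻¹) (N : ℕ) :
    Measurable fun p : ℝ × Config (N + 1) (Fin 3) T3 => (regFlowCrux hσ hσ' N).flow p.1 p.2 :=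
  Alexander.measurable_regFlow_uncurry ((hsDiameter_le hσ.le N).trans_lt hσ')

/-- `σ < 1/2` in the two spellings used by the tree. [folklore] -/
theorem half_le_of_lt_half {σ : ℝ} (hσ' : σ < 2⁻¹) : σ ≤ 1 / 2 := by
  rw [one_div]; exact hσ'.le

/-- Integrability of `llr1` under the tilted Gaussian. [folklore] -/
theorem integrable_llr1 {θ₁ : ℝ} (hθ₁ : 0 < θ₁) (u₁ : V3) :
    Integrable (llr1 θ₁ u₁) (gaussMeasure u₁ θ₁) := by
  have h2 : Integrable (fun v : V3 => ‖v‖ ^ 2) (gaussMeasure u₁ θ₁) :=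
    (IsGaussian.memLp_id _ 2 (by simp)).integrable_norm_pow (by norm_num)
  have h3 : Integrable (fun v : V3 => ‖v - u₁‖ ^ 2) (gaussMeasure u₁ θ₁) :=
    ((IsGaussian.memLp_id (gaussMeasure u₁ θ₁) 2 (by simp)).sub (memLp_const u₁)).integrable_norm_pow
      (by norm_num)
  have : llr1 θ₁ u₁ = fun v => 3 / 2 * Real.log θ₁ - ‖v‖ ^ 2 / 2 + ‖v - u₁‖ ^ 2 / (2 * θ₁) :=
    funext fun v => llr1_eq hθ₁ u₁ v
  rw [this]
  exact ((integrable_const _).sub (h2.div_const 2)).add (h3.div_const _)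

/-- A bounded continuous function is integrable under the tilted Gaussian. [folklore] -/
theorem integrable_of_bounded_gaussMeasure {g : V3 → ℝ} (hg : Continuous g) {K : ℝ}
    (hgK : ∀ v, |g v| ≤ K) (u₁ : V3) (θ₁ : ℝ) : Integrable g (gaussMeasure u₁ θ₁) :=
  (integrable_const K).mono' hg.aestronglyMeasurable (ae_of_all _ fun v => by
    rw [Real.norm_eq_abs]; exact hgK v)

/-- **The expectation of a kinetic-window time average under an invariant Gibbs law is the static
expectation** (Fubini + `(Φ_s)_# G = G`), for the regular flow and a bounded measurable observable.
[folklore] -/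
theorem integral_windowAvg_regFlowCrux {σ : ℝ} (hσ : 0 < σ) (hσ' : σ < 2⁻¹) (a θ : ℝ) (u : V3)
    (ha : 0 < a) (hθ : 0 < θ) (N : ℕ) {O : Config (N + 1) (Fin 3) T3 → ℝ} (hO : Measurable O)
    {C : ℝ} (hOb : ∀ z, |O z| ≤ C) {h : ℝ} (hh : 0 < h) :
    ∫ z, (h⁻¹ * ∫ s in (0 : ℝ)..h, O ((regFlowCrux hσ hσ' N).flow s z))
        ∂(localGibbsLaw σ (fun _ => a) (fun _ => u) (fun _ => θ) N (regFlowCrux hσ hσ' N)) =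
      ∫ z, O z ∂(localGibbsLaw σ (fun _ => a) (fun _ => u) (fun _ => θ) N (regFlowCrux hσ hσ' N)) := by
  have hflow := measurable_regFlowCrux_uncurry hσ hσ' N
  set Φ := regFlowCrux hσ hσ' N with hΦ
  set Q := localGibbsLaw σ (fun _ => a) (fun _ => u) (fun _ => θ) N Φ with hQ
  haveI : IsProbabilityMeasure Q := isProbabilityMeasure_localGibbsLaw continuous_const
    continuous_const continuous_const (fun _ => ha) (fun _ => hθ) (half_le_of_lt_half hσ') N Φ
  haveI : IsFiniteMeasure ((volume : Measure ℝ).restrict (Set.Ioc (0 : ℝ) h)) :=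
    ⟨by simp [Real.volume_Ioc]⟩
  rw [integral_const_mul]
  simp_rw [intervalIntegral.integral_of_le hh.le]
  have hmeas : Measurable (Function.uncurry fun (s : ℝ) (z : Config (N + 1) (Fin 3) T3) =>
      O (Φ.flow s z)) := hO.comp hflow
  have hint : Integrable (Function.uncurry fun (s : ℝ) (z : Config (N + 1) (Fin 3) T3) =>
      O (Φ.flow s z)) (((volume : Measure ℝ).restrict (Set.Ioc (0 : ℝ) h)).prod Q) := by
    refine (integrable_const C).mono' hmeas.aestronglyMeasurable (ae_of_all _ fun p => ?_)
    rw [Real.norm_eq_abs]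
    exact hOb _
  rw [← integral_integral_swap hint]
  have hinv : ∀ s : ℝ, ∫ z, O (Φ.flow s z) ∂Q = ∫ z, O z ∂Q := fun s =>
    integral_comp_flow_localGibbsLaw_const σ a θ u N Φ s hO.aestronglyMeasurable
  simp_rw [hinv]
  rw [setIntegral_const, Measure.real, Real.volume_Ioc, sub_zero, ENNReal.toReal_ofReal hh.le,
    smul_eq_mul, ← mul_assoc, inv_mul_cancel₀ hh.ne', one_mul]

/-- **The Gibbs-tilt lower bound** (Donsker–Varadhan with an INVARIANT tilt). For the reference
homogeneous Gibbs law `G_N` (`a = θ = 1`, `u₀ = 0`) of `N + 1` hard spheres at reduced density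
`σ < 1/2`, the regular Alexander flow, a bounded continuous one-body `g` and any window `h > 0`:
`exp((N+1) · ∫ [g(u₁ + √θ₁ w) + llr1(u₁ + √θ₁ w)] dγ(w)) ≤ ∫⁻ exp(h⁻¹ ∫₀ʰ ∑ᵢ g(vᵢ(s)) ds) dG_N`,
i.e. `(N+1)⁻¹ log E e^{Y} ≥ E_{N(u₁,θ₁)} g − KL(N(u₁,θ₁) ‖ N(0,1))` — the tilted law is again a
homogeneous Gibbs law, hence flow-invariant, so the time average costs nothing. [folklore] -/
theorem tilt_lower_bound {σ : ℝ} (hσ : 0 < σ) (hσ' : σ < 2⁻¹) {θ₁ : ℝ} (hθ₁ : 0 < θ₁) (u₁ : V3)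
    (N : ℕ) {g : V3 → ℝ} (hg : Continuous g) {K : ℝ} (hgK : ∀ v, |g v| ≤ K) {h : ℝ} (hh : 0 < h) :
    ENNReal.ofReal (Real.exp (((N + 1 : ℕ) : ℝ) *
        ∫ w, (g (u₁ + Real.sqrt θ₁ • w) + llr1 θ₁ u₁ (u₁ + Real.sqrt θ₁ • w)) ∂stdGaussian V3)) ≤
      ∫⁻ z, ENNReal.ofReal (Real.exp (h⁻¹ * ∫ s in (0 : ℝ)..h,
          ∑ i, g (((regFlowCrux hσ hσ' N).flow s z i).2)))
        ∂(localGibbsLaw σ (fun _ => 1) (fun _ => 0) (fun _ => 1) N (regFlowCrux hσ hσ' N)) := by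
  have hflow := measurable_regFlowCrux_uncurry hσ hσ' N
  set Φ := regFlowCrux hσ hσ' N with hΦ
  have hσ2 : σ ≤ 1 / 2 := half_le_of_lt_half hσ'
  rw [localGibbsLaw_eq, localGibbsMeasure_ref_eq_withDensity σ hθ₁ u₁ N,
    ← localGibbsLaw_eq σ _ _ _ N Φ]
  set Q := localGibbsLaw σ (fun _ => 1) (fun _ => u₁) (fun _ => θ₁) N Φ with hQ
  haveI : IsProbabilityMeasure Q := isProbabilityMeasure_localGibbsLaw continuous_const
    continuous_const continuous_const (fun _ => one_pos) (fun _ => hθ₁) hσ2 N Φ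
  -- the static observable
  set O : Config (N + 1) (Fin 3) T3 → ℝ := fun z => ∑ i, g ((z i).2) with hO
  have hOm : Measurable O :=
    Finset.measurable_sum _ fun i _ => hg.measurable.comp (measurable_pi_apply i).snd
  have hK0 : 0 ≤ K := (abs_nonneg _).trans (hgK 0)
  have hOb : ∀ z, |O z| ≤ (N + 1 : ℕ) * K := fun z => by
    calc |O z| ≤ ∑ i, |g ((z i).2)| := Finset.abs_sum_le_sum_abs _ _
      _ ≤ ∑ _i : Fin (N + 1), K := Finset.sum_le_sum fun i _ => hgK _
      _ = (N + 1 : ℕ) * K := by simp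
  -- the window average
  set Y : Config (N + 1) (Fin 3) T3 → ℝ := fun z => h⁻¹ * ∫ s in (0 : ℝ)..h, O (Φ.flow s z)
    with hY
  have hunc : StronglyMeasurable (Function.uncurry fun (s : ℝ) (z : Config (N + 1) (Fin 3) T3) =>
      O (Φ.flow s z)) := (hOm.comp hflow).stronglyMeasurable
  have hYm : Measurable Y := by
    have h1 : (fun z : Config (N + 1) (Fin 3) T3 => ∫ s in (0 : ℝ)..h, O (Φ.flow s z)) =
        fun z => ∫ s, O (Φ.flow s z) ∂((volume : Measure ℝ).restrict (Set.Ioc 0 h)) := by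
      funext z; rw [intervalIntegral.integral_of_le hh.le]
    have h2 : Measurable fun z : Config (N + 1) (Fin 3) T3 => ∫ s in (0 : ℝ)..h, O (Φ.flow s z) := by
      rw [h1]
      exact (hunc.integral_prod_left (μ := (volume : Measure ℝ).restrict (Set.Ioc 0 h))).measurable
    exact measurable_const.mul h2
  have hYb : ∀ z, |Y z| ≤ (N + 1 : ℕ) * K := fun z => by
    rw [hY]
    simp only
    rw [abs_mul, abs_inv, abs_of_pos hh]
    have hI : |∫ s in (0 : ℝ)..h, O (Φ.flow s z)| ≤ (N + 1 : ℕ) * K * |h - 0| := by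
      have := intervalIntegral.norm_integral_le_of_norm_le_const (a := 0) (b := h)
        (f := fun s => O (Φ.flow s z)) (C := (N + 1 : ℕ) * K) fun s _ => by
          rw [Real.norm_eq_abs]; exact hOb _
      simpa only [Real.norm_eq_abs] using this
    rw [sub_zero, abs_of_pos hh] at hI
    calc h⁻¹ * |∫ s in (0 : ℝ)..h, O (Φ.flow s z)| ≤ h⁻¹ * ((N + 1 : ℕ) * K * h) :=
          mul_le_mul_of_nonneg_left hI (inv_nonneg.2 hh.le)
      _ = (N + 1 : ℕ) * K := by field_simp
  have hYi : Integrable Y Q :=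
    (integrable_const (((N + 1 : ℕ) : ℝ) * K)).mono' hYm.aestronglyMeasurable
      (ae_of_all _ fun z => by rw [Real.norm_eq_abs]; exact hYb z)
  have hgi : Integrable g (gaussMeasure u₁ θ₁) := integrable_of_bounded_gaussMeasure hg hgK u₁ θ₁
  have hLi : Integrable (llrConfig θ₁ u₁ : Config (N + 1) (Fin 3) T3 → ℝ) Q := by
    rw [hQ, localGibbsLaw_eq]
    exact integrable_sum_vel_localGibbsMeasure_const σ 1 θ₁ u₁ one_pos hθ₁ hσ2 N
      (integrable_llr1 hθ₁ u₁)
  have hOi : Integrable O Q := by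
    rw [hQ, localGibbsLaw_eq]
    exact integrable_sum_vel_localGibbsMeasure_const σ 1 θ₁ u₁ one_pos hθ₁ hσ2 N hgi
  have key := ofReal_exp_le_lintegral_withDensity Q hYm (measurable_llrConfig hθ₁ u₁ _) hYi hLi
  have hYO : ∫ z, Y z ∂Q = ∫ z, O z ∂Q :=
    integral_windowAvg_regFlowCrux hσ hσ' 1 θ₁ u₁ one_pos hθ₁ N hOm hOb hh
  have hsum : ∫ z, O z ∂Q + ∫ z, llrConfig θ₁ u₁ z ∂Q = ((N + 1 : ℕ) : ℝ) *
      ∫ w, (g (u₁ + Real.sqrt θ₁ • w) + llr1 θ₁ u₁ (u₁ + Real.sqrt θ₁ • w)) ∂stdGaussian V3 := by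
    rw [← integral_add hOi hLi]
    have hfun : (fun z => O z + llrConfig θ₁ u₁ z) =
        fun z : Config (N + 1) (Fin 3) T3 => ∑ i, (g ((z i).2) + llr1 θ₁ u₁ ((z i).2)) := by
      funext z; simp only [hO, llrConfig, Finset.sum_add_distrib]
    rw [hfun, hQ, localGibbsLaw_eq,
      integral_sum_vel_localGibbsMeasure_const σ 1 θ₁ u₁ one_pos hθ₁ hσ2 N
        (f := fun v => g v + llr1 θ₁ u₁ v) (hgi.add (integrable_llr1 hθ₁ u₁)),
      integral_gaussMeasure u₁ hθ₁]
  rw [hYO, hsum] at key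
  exact key

/-- **Tightness of the crux bound from below (`Λ ≥ 0`)**: for a CENTRED bounded continuous `g`
(`∫ g dγ = 0`, in particular for every admissible `g` of the crux) the LD functional of the reference
Gibbs law through the regular flow is `≥ 1 = e^{0·(N+1)}` at every window and every `N` — the trivial
tilt `θ₁ = 1`, `u₁ = 0` in `tilt_lower_bound` (Jensen + invariance). So `δ < 0` is impossible: the crux
asserts exactly that the per-particle pressure tends to `0⁺`. [folklore] -/
theorem one_le_lintegral_exp_window {σ : ℝ} (hσ : 0 < σ) (hσ' : σ < 2⁻¹) (N : ℕ) {g : V3 → ℝ}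
    (hg : Continuous g) {K : ℝ} (hgK : ∀ v, |g v| ≤ K) (hg0 : ∫ w, g w ∂stdGaussian V3 = 0)
    {h : ℝ} (hh : 0 < h) :
    1 ≤ ∫⁻ z, ENNReal.ofReal (Real.exp (h⁻¹ * ∫ s in (0 : ℝ)..h,
          ∑ i, g (((regFlowCrux hσ hσ' N).flow s z i).2)))
        ∂(localGibbsLaw σ (fun _ => 1) (fun _ => 0) (fun _ => 1) N (regFlowCrux hσ hσ' N)) := by
  have key := tilt_lower_bound hσ hσ' one_pos (0 : V3) N hg hgK hh
  have h0 : ∀ w : V3, llr1 1 0 w = 0 := fun w => by simp [llr1]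
  simp only [zero_add, Real.sqrt_one, one_smul, h0, add_zero, hg0, mul_zero, Real.exp_zero,
    ENNReal.ofReal_one] at key
  exact key

end Assembly

end KineticFluxLdDecayTilt
end Summit.AtomisticToContinuum.HydrodynamicLimit.Theorems
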